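import Summits.QuantumFields.BalabanUV.T4Continuum.Support.NE3HessForm
import Summits.QuantumFields.BalabanUV.T4Continuum.Support.NE7FlatAverageCurlCommutation
import Summits.QuantumFields.BalabanUV.T4Continuum.Support.AveragingDeficitHSInner
import Summits.QuantumFields.BalabanUV.T4Continuum.Support.NE7ConstantFluxBackground
import HarnessLib

/-!
# NE7CommutingHessForm — IN THE COMMUTING (ABELIAN) SECTOR ROW NE3's HESSIAN FORM OF THE WILSON ACTION IS THE CURVATURE-WEIGHTED MAXWELL FORM:
# `hess V X X W = Σ_{p∈W} Re tr[(curl_1 X(p))ᴴ (curl_1 X(p)) V(∂p)]∕n`, hence `|hess V X X W − Σ_p ‖curl_1 X(p)‖²_{HS∕n}| ≤ a·Σ_p ‖curl_1 X(p)‖²_{HS∕n}` when `‖V(∂p) − 1‖ ≤ a` on `W`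

Lineage `b2b-balaban-t4-ne7-p1` (CRUX PROVER NE7 #1 = OWNER of BINDER row NE7), generation 116 — first brick of the CORRECTED successor target ROAD-G116 §7 (G-ab) «the abelian sector
of the curved positivity».  The bordered Hessian of the constrained minimal action at a datum `V₀` (✓ `NE7MinActHessianHessForm.minAct_hessian_hessForm_allData`) minimises
`w·hess U♯ X̃ X̃ W − (multiplier term)`; when the values of the background `V` and of the direction `X` pairwise COMMUTE (U(1) data; simultaneously diagonal data), every transported
commutator in ✓ `NE3HessForm.dcurlAt` vanishes and every `Ad` is the identity, so (every `d`, every `n`, [folklore]; 0 def, 0 sorry):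
* (✓ `NE7ConstantFluxBackground.Ad_eq_of_commute`, gen 80) **`curlAt_eq_flat_of_commute`** (`curlAt V X = curl_1 X`, the flat four-term curl); **`dcurlAt_self_eq_zero_of_commute`** (`dcurlAt V X X = 0`);
* **`hessPlaqAt_eq_of_commute`**: `hessPlaqAt V X X z μ ν = −nReTr ((curl_1 X)² · V(∂p))`, and for skew `X`: `= hsRe (curl_1 X) (curl_1 X · V(∂p))`;
* **`abs_hessPlaqAt_sub_nhsNormSq_le`**: `|hessPlaqAt V X X z μ ν − nhsNormSq (curl_1 X z μ ν)| ≤ ‖V(∂p) − 1‖ · nhsNormSq (curl_1 X z μ ν)` (Hilbert–Schmidt Cauchy–Schwarz ✓ `abs_hsRe_le`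
  + ✓ `nhsNorm_mul_le_nhsNorm_mul_opNorm`), and on a window **`abs_hess_sub_curlSq_le`**, **`hess_ge_of_commute`** ∕ **`hess_le_of_commute`**:
  `(1 − a)·Σ_{p∈W} nhsNormSq (curl_1 X p) ≤ hess V X X W ≤ (1 + a)·Σ_{p∈W} nhsNormSq (curl_1 X p)` whenever `‖V(∂p) − 1‖ ≤ a` on `W`.
So in the abelian sector the quadratic form minimised by the bordered Hessian is, up to the factor `1 ± a`, the FLAT one — the multiplier term is the remaining (affine-constraint)
question of (G-ab).  HONEST FRAMING: lattice kinematics∕matrix inequalities under an explicit commutation HYPOTHESIS (no U(1) instance is built); nothing about Bałaban's minimisers;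
NOT NE7 as a spine node; spine 0∕9; NOT infinite volume, NOT mass gap, NOT BetaPertH, NOT Clay.
-/

set_option autoImplicit false

open scoped BigOperators Matrix Matrix.Norms.L2Operator
open NormedSpace Finset

namespace Summit.QuantumFields.BalabanUV.T4Continuum.NE7CommutingHessForm

open Literature.MathematicalPhysics.QuantumFieldTheory.Balaban1983to89
open B7Prop1Explicit B7Prop2Explicit UnitaryModel MatrixNorms
open T4AveragingDeficitWall (Ad curlAt IsSkewDir)
open MinimalActionWitness (flatCfg)
open NE3HessForm (dcurlAt hessPlaqAt hessPlaq hess)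
open AveragingDeficitHSInner (hsRe hsRe_eq hsRe_self hsRe_sub_right abs_hsRe_le)
open NE7FlatAverageCurlCommutation (curlAt_flatCfg)
open NE7ConstantFluxBackground (Ad_eq_of_commute)

noncomputable section

variable {d : ℕ} {n : Type} [Fintype n] [DecidableEq n]

/-! ## §1 `Ad` and the dressed curl under commutation -/

/-- `Ad_u 0 = 0`. [folklore] -/
theorem Ad_zero (u : (Matrix n n ℂ)ˣ) : Ad u (0 : Matrix n n ℂ) = 0 := by
  simp [Ad]

/-- **THE DRESSED CURL IS THE FLAT CURL** when the background commutes with the direction: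
`curlAt V X z μ ν = X(z,μ) + X(z+e_μ,ν) − X(z+e_ν,μ) − X(z,ν)`. [folklore] -/
theorem curlAt_eq_flat_of_commute {V : Site d → Fin d → (Matrix n n ℂ)ˣ} {X : Site d → Fin d → Matrix n n ℂ}
    (hVX : ∀ (x : Site d) (κ : Fin d) (y : Site d) (μ : Fin d), Commute ((V x κ : (Matrix n n ℂ)ˣ) : Matrix n n ℂ) (X y μ)) (z : Site d) (μ ν : Fin d) :
    curlAt V X z μ ν = curlAt (flatCfg : Site d → Fin d → (Matrix n n ℂ)ˣ) X z μ ν := by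
  rw [curlAt_flatCfg, curlAt]
  rw [Ad_eq_of_commute (hVX _ _ _ _), Ad_eq_of_commute, Ad_eq_of_commute, Ad_eq_of_commute]
  · rw [Units.val_mul, Units.val_mul]
    exact ((hVX _ _ _ _).mul_left (hVX _ _ _ _)).mul_left (Commute.units_inv_left (hVX _ _ _ _))
  · rw [Units.val_mul]; exact (hVX _ _ _ _).mul_left (hVX _ _ _ _)
  · rw [Units.val_mul]; exact (hVX _ _ _ _).mul_left (hVX _ _ _ _)

/-- **THE DERIVATIVE OF THE DRESSED CURL ALONG THE DIRECTION ITSELF VANISHES** in the commuting sector: `dcurlAt V X X = 0` (every term is a transported commutator of two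
commuting values). [folklore] -/
theorem dcurlAt_self_eq_zero_of_commute {V : Site d → Fin d → (Matrix n n ℂ)ˣ} {X : Site d → Fin d → Matrix n n ℂ}
    (hVX : ∀ (x : Site d) (κ : Fin d) (y : Site d) (μ : Fin d), Commute ((V x κ : (Matrix n n ℂ)ˣ) : Matrix n n ℂ) (X y μ))
    (hXX : ∀ (x : Site d) (κ : Fin d) (y : Site d) (μ : Fin d), Commute (X x κ) (X y μ)) (z : Site d) (μ ν : Fin d) :
    dcurlAt V X X z μ ν = 0 := by
  have e1 : Ad (V (z + e μ) ν) (X (z + e μ) ν) = X (z + e μ) ν := Ad_eq_of_commute (hVX _ _ _ _)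
  have e2 : Ad (V (z + e μ) ν) (X (z + e ν) μ) = X (z + e ν) μ := Ad_eq_of_commute (hVX _ _ _ _)
  have e3 : Ad (V (z + e μ) ν * (V (z + e ν) μ)⁻¹) (X z ν) = X z ν := by
    refine Ad_eq_of_commute ?_
    rw [Units.val_mul]
    exact (hVX _ _ _ _).mul_left (Commute.units_inv_left (hVX _ _ _ _))
  have e4 : Ad (V (z + e ν) μ)⁻¹ (X z ν) = X z ν := Ad_eq_of_commute (Commute.units_inv_left (hVX _ _ _ _))
  have c0 : ∀ a b : Matrix n n ℂ, Commute a b → a * b - b * a = 0 := fun a b h => sub_eq_zero.mpr h.eq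
  have c1 : X z μ * X (z + e μ) ν - X (z + e μ) ν * X z μ = 0 := c0 _ _ (hXX _ _ _ _)
  have c2 : X (z + e μ) ν * X (z + e μ) ν - X (z + e μ) ν * X (z + e μ) ν = 0 := sub_self _
  have c3 : X z μ * X (z + e ν) μ - X (z + e ν) μ * X z μ = 0 := c0 _ _ (hXX _ _ _ _)
  have c4 : X (z + e μ) ν * X (z + e ν) μ - X (z + e ν) μ * X (z + e μ) ν = 0 := c0 _ _ (hXX _ _ _ _)
  have c5 : X z μ * X z ν - X z ν * X z μ = 0 := c0 _ _ (hXX _ _ _ _)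
  have c6 : (X (z + e μ) ν - X (z + e ν) μ) * X z ν - X z ν * (X (z + e μ) ν - X (z + e ν) μ) = 0 :=
    c0 _ _ ((hXX _ _ _ _).sub_left (hXX _ _ _ _))
  have c7 : X z μ * X z μ - X z μ * X z μ = 0 := sub_self _
  simp only [dcurlAt, e1, e2, e3, e4, c1, c2, c3, c4, c5, c6, c7, Ad_zero, add_zero, sub_self]

/-! ## §2 The Hessian density and its two-sided comparison with the flat Maxwell density -/

/-- **THE HESSIAN DENSITY IN THE COMMUTING SECTOR**: `hessPlaqAt V X X z μ ν = −nReTr ((curl_1 X)² · V(∂p))`. [folklore] -/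
theorem hessPlaqAt_eq_of_commute {V : Site d → Fin d → (Matrix n n ℂ)ˣ} {X : Site d → Fin d → Matrix n n ℂ}
    (hVX : ∀ (x : Site d) (κ : Fin d) (y : Site d) (μ : Fin d), Commute ((V x κ : (Matrix n n ℂ)ˣ) : Matrix n n ℂ) (X y μ))
    (hXX : ∀ (x : Site d) (κ : Fin d) (y : Site d) (μ : Fin d), Commute (X x κ) (X y μ)) (z : Site d) (μ ν : Fin d) :
    hessPlaqAt V X X z μ ν
      = -nReTr (curlAt (flatCfg : Site d → Fin d → (Matrix n n ℂ)ˣ) X z μ ν * curlAt (flatCfg : Site d → Fin d → (Matrix n n ℂ)ˣ) X z μ ν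
          * ((hol V z (plaqWord μ ν) : (Matrix n n ℂ)ˣ) : Matrix n n ℂ)) := by
  rw [hessPlaqAt, dcurlAt_self_eq_zero_of_commute hVX hXX, zero_add, curlAt_eq_flat_of_commute hVX]

omit [DecidableEq n] in
/-- `nReTr (Xᴴ Y) = hsRe X Y`. [folklore] -/
theorem nReTr_conjTranspose_mul (X Y : Matrix n n ℂ) : nReTr (Xᴴ * Y) = hsRe X Y := by
  rw [hsRe_eq, nReTr]

omit [DecidableEq n] in
/-- For skew `C`: `−nReTr (C·C·H) = hsRe C (C·H)`. [folklore] -/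
theorem neg_nReTr_mul_mul_of_skew {C : Matrix n n ℂ} (hC : C ∈ skewAdjoint (Matrix n n ℂ)) (H : Matrix n n ℂ) :
    -nReTr (C * C * H) = hsRe C (C * H) := by
  have hC' : Cᴴ = -C := by
    have := hC
    rw [skewAdjoint.mem_iff] at this
    exact this
  rw [← nReTr_conjTranspose_mul, hC', neg_mul, mul_assoc]
  simp only [nReTr, Matrix.trace_neg, Complex.neg_re, neg_div]

/-- **THE HESSIAN DENSITY IS THE MAXWELL DENSITY UP TO THE PLAQUETTE RADIUS**: in the commuting sector, for skew `X`,
`|hessPlaqAt V X X z μ ν − nhsNormSq (curl_1 X z μ ν)| ≤ ‖V(∂p) − 1‖ · nhsNormSq (curl_1 X z μ ν)`. [folklore] -/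
theorem abs_hessPlaqAt_sub_nhsNormSq_le {V : Site d → Fin d → (Matrix n n ℂ)ˣ} {X : Site d → Fin d → Matrix n n ℂ}
    (hVX : ∀ (x : Site d) (κ : Fin d) (y : Site d) (μ : Fin d), Commute ((V x κ : (Matrix n n ℂ)ˣ) : Matrix n n ℂ) (X y μ))
    (hXX : ∀ (x : Site d) (κ : Fin d) (y : Site d) (μ : Fin d), Commute (X x κ) (X y μ)) (hX : IsSkewDir X) (z : Site d) (μ ν : Fin d) :
    |hessPlaqAt V X X z μ ν - nhsNormSq (curlAt (flatCfg : Site d → Fin d → (Matrix n n ℂ)ˣ) X z μ ν)|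
      ≤ ‖((hol V z (plaqWord μ ν) : (Matrix n n ℂ)ˣ) : Matrix n n ℂ) - 1‖ * nhsNormSq (curlAt (flatCfg : Site d → Fin d → (Matrix n n ℂ)ˣ) X z μ ν) := by
  set C : Matrix n n ℂ := curlAt (flatCfg : Site d → Fin d → (Matrix n n ℂ)ˣ) X z μ ν with hCdef
  set H : Matrix n n ℂ := ((hol V z (plaqWord μ ν) : (Matrix n n ℂ)ˣ) : Matrix n n ℂ) with hHdef
  have hC : C ∈ skewAdjoint (Matrix n n ℂ) := by
    rw [hCdef, curlAt_flatCfg]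
    exact (skewAdjoint _).sub_mem ((skewAdjoint _).sub_mem ((skewAdjoint _).add_mem (hX _ _) (hX _ _)) (hX _ _)) (hX _ _)
  rw [hessPlaqAt_eq_of_commute hVX hXX, neg_nReTr_mul_mul_of_skew hC, ← hsRe_self, ← hsRe_sub_right]
  have hfac : C * H - C = C * (H - 1) := by rw [mul_sub, mul_one]
  rw [hfac]
  calc |hsRe C (C * (H - 1))| ≤ nhsNorm C * nhsNorm (C * (H - 1)) := abs_hsRe_le _ _
    _ ≤ nhsNorm C * (nhsNorm C * ‖H - 1‖) := mul_le_mul_of_nonneg_left (nhsNorm_mul_le_nhsNorm_mul_opNorm _ _) (Real.sqrt_nonneg _)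
    _ = ‖H - 1‖ * nhsNormSq C := by rw [← nhsNorm_sq]; ring
    _ = ‖H - 1‖ * hsRe C C := by rw [hsRe_self]

/-- **WINDOW FORM**: `|hess V X X W − Σ_{p∈W} nhsNormSq (curl_1 X p)| ≤ a·Σ_{p∈W} nhsNormSq (curl_1 X p)` when `‖V(∂p) − 1‖ ≤ a` on `W` (commuting sector, skew `X`). [folklore] -/
theorem abs_hess_sub_curlSq_le {V : Site d → Fin d → (Matrix n n ℂ)ˣ} {X : Site d → Fin d → Matrix n n ℂ}
    (hVX : ∀ (x : Site d) (κ : Fin d) (y : Site d) (μ : Fin d), Commute ((V x κ : (Matrix n n ℂ)ˣ) : Matrix n n ℂ) (X y μ))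
    (hXX : ∀ (x : Site d) (κ : Fin d) (y : Site d) (μ : Fin d), Commute (X x κ) (X y μ)) (hX : IsSkewDir X)
    (W : Finset (T4AveragingDeficitWall.Plaq d)) {a : ℝ} (ha : ∀ p ∈ W, ‖((hol V p.1 (plaqWord p.2.1.1 p.2.1.2) : (Matrix n n ℂ)ˣ) : Matrix n n ℂ) - 1‖ ≤ a) :
    |hess V X X W - ∑ p ∈ W, nhsNormSq (T4AveragingDeficitWall.curl (flatCfg : Site d → Fin d → (Matrix n n ℂ)ˣ) X p)|
      ≤ a * ∑ p ∈ W, nhsNormSq (T4AveragingDeficitWall.curl (flatCfg : Site d → Fin d → (Matrix n n ℂ)ˣ) X p) := by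
  rw [hess, ← Finset.sum_sub_distrib, Finset.mul_sum]
  refine (Finset.abs_sum_le_sum_abs _ _).trans (Finset.sum_le_sum fun p hp => ?_)
  exact (abs_hessPlaqAt_sub_nhsNormSq_le hVX hXX hX p.1 p.2.1.1 p.2.1.2).trans
    (mul_le_mul_of_nonneg_right (ha p hp) (nhsNormSq_nonneg _))

/-- **LOWER BOUND**: `(1 − a)·Σ_{p∈W} nhsNormSq (curl_1 X p) ≤ hess V X X W` (commuting sector, skew `X`, `‖V(∂p) − 1‖ ≤ a` on `W`). [folklore] -/
theorem hess_ge_of_commute {V : Site d → Fin d → (Matrix n n ℂ)ˣ} {X : Site d → Fin d → Matrix n n ℂ}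
    (hVX : ∀ (x : Site d) (κ : Fin d) (y : Site d) (μ : Fin d), Commute ((V x κ : (Matrix n n ℂ)ˣ) : Matrix n n ℂ) (X y μ))
    (hXX : ∀ (x : Site d) (κ : Fin d) (y : Site d) (μ : Fin d), Commute (X x κ) (X y μ)) (hX : IsSkewDir X)
    (W : Finset (T4AveragingDeficitWall.Plaq d)) {a : ℝ} (ha : ∀ p ∈ W, ‖((hol V p.1 (plaqWord p.2.1.1 p.2.1.2) : (Matrix n n ℂ)ˣ) : Matrix n n ℂ) - 1‖ ≤ a) :
    (1 - a) * ∑ p ∈ W, nhsNormSq (T4AveragingDeficitWall.curl (flatCfg : Site d → Fin d → (Matrix n n ℂ)ˣ) X p) ≤ hess V X X W := by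
  have h := abs_hess_sub_curlSq_le hVX hXX hX W ha
  rw [abs_le] at h
  linarith [h.1]

/-- **UPPER BOUND**: `hess V X X W ≤ (1 + a)·Σ_{p∈W} nhsNormSq (curl_1 X p)` (commuting sector, skew `X`, `‖V(∂p) − 1‖ ≤ a` on `W`). [folklore] -/
theorem hess_le_of_commute {V : Site d → Fin d → (Matrix n n ℂ)ˣ} {X : Site d → Fin d → Matrix n n ℂ}
    (hVX : ∀ (x : Site d) (κ : Fin d) (y : Site d) (μ : Fin d), Commute ((V x κ : (Matrix n n ℂ)ˣ) : Matrix n n ℂ) (X y μ))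
    (hXX : ∀ (x : Site d) (κ : Fin d) (y : Site d) (μ : Fin d), Commute (X x κ) (X y μ)) (hX : IsSkewDir X)
    (W : Finset (T4AveragingDeficitWall.Plaq d)) {a : ℝ} (ha : ∀ p ∈ W, ‖((hol V p.1 (plaqWord p.2.1.1 p.2.1.2) : (Matrix n n ℂ)ˣ) : Matrix n n ℂ) - 1‖ ≤ a) :
    hess V X X W ≤ (1 + a) * ∑ p ∈ W, nhsNormSq (T4AveragingDeficitWall.curl (flatCfg : Site d → Fin d → (Matrix n n ℂ)ˣ) X p) := by
  have h := abs_hess_sub_curlSq_le hVX hXX hX W ha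
  rw [abs_le] at h
  linarith [h.2]

end

end Summit.QuantumFields.BalabanUV.T4Continuum.NE7CommutingHessForm
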